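import Summits.ValiantsHypothesis.ValiantsHypothesis.Theorems.BarrierLeverPartitionMinorsHitByVPHiddenStatesSymbolic

/-!
# Route BarrierLever — item `PartitionMinorsHitByVP` (stmt-ValiantsHypothesis-19717), line `hidden_states`:
# the ADD-ROW LEMMA — generic goodness survives adding a maximal row together with a free column

Helper file (`--supports stmt-ValiantsHypothesis-19717`; cell valiant-natproofs, rung V4, 𝒟-side door (c); prover seat val-np-p6 gen 9).
Definition-light (one bookkeeping `def`: the algebra homomorphism `rowShift`; one abbreviation-free `def phi` of a cut value). Closes NO item.

THE LEMMA (`SymbJoin.symGood_addRow`). Let `(u, e)` be a join configuration with `r₀ + 1` rows and columns, `i₀` a row and `k₀` a column.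
Suppose
* the row `u i₀` is contained in NO other row (`hmax`; automatic when the other rows form a lower set not containing `u i₀`, or when
  `u i₀` has maximal cardinality);
* the column `k₀` is FREE RELATIVE TO ITS PIECE: there are cut constants `c : Option (Fin K) → ℂ` whose affine functional
  `φ_c(J) = c none + Σ_{q ∈ J} c (some q)` takes the value `1` at the hidden set of `k₀` and `0` at the hidden set of every other column of
  the same piece (`hnew`, `hold`; e.g. `k₀` carries a private state, `symGood_addRow_private`);
* the configuration without row `i₀` and column `k₀` is generically good (`symDet ≠ 0`).
Then `(u, e)` is generically good.

PROOF. Shift the symbolic table of the piece `p₀` of `k₀` along `c` on the coordinates of `S = u i₀` by ONE new indeterminate `T`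
(`rowShift`: `X_{(p₀,o,a)} ↦ X_{(p₀,o,a)} + c(o)·T` for `a ∈ S`): the hidden point of `k₀` moves by `T` on `S`, every other hidden point is
fixed (`φ_c = 0` there, or another piece). In the shifted matrix the column `k₀` has entries `∏_{a ∈ u i} (s_a + [a ∈ S] T)`, of `T`-degree
`|u i ∩ S| < |S|` for `i ≠ i₀` (`hmax`) and monic of degree `|S|` for `i = i₀`; all other columns are constant. By Laplace expansion along
`k₀` the coefficient of `T^{|S|}` in the shifted determinant is `± symDet` of the smaller configuration, which is nonzero; so the shifted
determinant, hence `symDet u e`, is nonzero.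

WHY IT MATTERS (memos HOME/val-np-p6/g8/MEMO-cuttree-valnp6-g8.md §5, HOME/val-np-p6/g9): every design of the cell is «structured pieces +
free points», and every adversary family is handled as «structured core + extra sets». The lemma is the kernel form of the slogan FREE POINTS
ABSORB ARBITRARY ROWS: if a design is generically good for a lower family `u`, then the design enlarged by `k` free columns is generically good
for EVERY family `u ⊔ {k further sets}` (add the new sets by non-decreasing size; each is then contained in no earlier row). In particular
universality of a position in the cut-tree / ball game is MONOTONE in the number of free points (census HOME/val-np-p6/g9/kit/univ2.py:
observed without exception at d = 5, 6), and every certified class `𝒰` of the line extends to `{u' ⊇ u ∈ 𝒰}` with the same structured pieces.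

WHAT THIS IS NOT: no statement about which structured designs are good; item 19717 OPEN; nothing on crux 14610 or VP ≠ VNP.
-/

set_option linter.dupNamespace false

namespace Summit.ValiantsHypothesis.ValiantsHypothesis.Theorems.BarrierLever.HiddenStates

open Finset Matrix MvPolynomial

noncomputable section

namespace SymbJoin

variable {h m K r : ℕ}

/-! ## 1. The one-parameter shift of a piece's table -/

/-- The cut value `φ_c(J) = c none + Σ_{q ∈ J} c (some q)` of the hidden set `J`. -/
def phi (c : Option (Fin K) → ℂ) (J : Finset (Fin K)) : ℂ := c none + ∑ q ∈ J, c (some q)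

/-- The shift `X_{(p,o,a)} ↦ X_{(p,o,a)} + [p = p₀ ∧ a ∈ S] · c(o) · T` of the symbolic table by one new indeterminate `T`
(an algebra homomorphism into the polynomial ring in `T` over the symbolic-table ring). -/
def rowShift (p₀ : Fin m) (c : Option (Fin K) → ℂ) (S : Finset (Fin h)) :
    MvPolynomial (Var m K h) ℂ →ₐ[ℂ] Polynomial (MvPolynomial (Var m K h) ℂ) :=
  MvPolynomial.aeval fun v : Var m K h =>
    Polynomial.C (X v) + (if v.1 = p₀ ∧ v.2.2 ∈ S then Polynomial.C (C (c v.2.1)) * Polynomial.X else 0)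

/-- The shift moves the `a`-coordinate of the hidden point of column `k` by `φ_c(J_k) · T` when `k` lies in piece `p₀` and `a ∈ S`,
and fixes it otherwise. -/
theorem rowShift_symPoint (p₀ : Fin m) (c : Option (Fin K) → ℂ) (S : Finset (Fin h))
    (e : Fin r → Fin m × Finset (Fin K)) (k : Fin r) (a : Fin h) :
    rowShift p₀ c S (symPoint e k a) = Polynomial.C (symPoint e k a) +
      (if (e k).1 = p₀ ∧ a ∈ S then Polynomial.C (C (phi c (e k).2)) * Polynomial.X else 0) := by
  classical
  simp only [rowShift, symPoint, map_add, map_sum, MvPolynomial.aeval_X]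
  by_cases hc : (e k).1 = p₀ ∧ a ∈ S
  · simp only [hc, and_self, if_true, phi, map_add, map_sum, Finset.sum_add_distrib, add_mul, Finset.sum_mul]
    ring
  · simp only [hc, if_false, add_zero]

/-- A column fixed by the shift (another piece, or cut value `0`): its entries become constants. -/
theorem rowShift_entry_const (p₀ : Fin m) (c : Option (Fin K) → ℂ) (S : Finset (Fin h))
    (e : Fin r → Fin m × Finset (Fin K)) (k : Fin r) (hk : (e k).1 = p₀ → phi c (e k).2 = 0) (U : Finset (Fin h)) :
    rowShift p₀ c S (∏ a ∈ U, symPoint e k a) = Polynomial.C (∏ a ∈ U, symPoint e k a) := by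
  classical
  rw [map_prod, map_prod]
  refine Finset.prod_congr rfl fun a _ => ?_
  rw [rowShift_symPoint]
  by_cases hp : (e k).1 = p₀
  · simp [hp, hk hp]
  · simp [hp]

/-- The moving column (cut value `1`): its entry in row `U` becomes `∏_{a ∈ U} (s_a + [a ∈ S] T)`. -/
theorem rowShift_entry_new (p₀ : Fin m) (c : Option (Fin K) → ℂ) (S : Finset (Fin h))
    (e : Fin r → Fin m × Finset (Fin K)) (k : Fin r) (hp : (e k).1 = p₀) (hk : phi c (e k).2 = 1) (U : Finset (Fin h)) :
    rowShift p₀ c S (∏ a ∈ U, symPoint e k a) =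
      ∏ a ∈ U, (Polynomial.C (symPoint e k a) + if a ∈ S then Polynomial.X else 0) := by
  classical
  rw [map_prod]
  refine Finset.prod_congr rfl fun a _ => ?_
  rw [rowShift_symPoint]
  by_cases ha : a ∈ S
  · simp [hp, hk, ha]
  · simp [ha]

/-- Degree bound for the moving column: `deg_T ∏_{a ∈ U} (s_a + [a ∈ S] T) ≤ |U ∩ S|`. -/
theorem natDegree_entry_new_le (S U : Finset (Fin h)) (s : Fin h → MvPolynomial (Var m K h) ℂ) :
    (∏ a ∈ U, (Polynomial.C (s a) + if a ∈ S then Polynomial.X else 0)).natDegree ≤ (U ∩ S).card := by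
  classical
  refine (Polynomial.natDegree_prod_le _ _).trans ?_
  have hb : ∀ a ∈ U, (Polynomial.C (s a) + if a ∈ S then Polynomial.X else 0).natDegree ≤ if a ∈ S then 1 else 0 := by
    intro a _
    by_cases ha : a ∈ S
    · rw [if_pos ha, if_pos ha]
      refine (Polynomial.natDegree_add_le _ _).trans ?_
      rw [Polynomial.natDegree_C]
      exact max_le (Nat.zero_le _) Polynomial.natDegree_X_le
    · rw [if_neg ha, if_neg ha, add_zero, Polynomial.natDegree_C]
  refine (Finset.sum_le_sum hb).trans ?_
  rw [Finset.sum_boole, ← Finset.filter_mem_eq_inter]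
  simp

/-- The moving column in its own row `S`: `∏_{a ∈ S} (s_a + T)` is monic of degree `|S|`, so its `T^{|S|}`-coefficient is `1`. -/
theorem coeff_entry_new_self (S : Finset (Fin h)) (s : Fin h → MvPolynomial (Var m K h) ℂ) :
    (∏ a ∈ S, (Polynomial.C (s a) + if a ∈ S then Polynomial.X else 0)).coeff S.card = 1 := by
  classical
  have heq : (∏ a ∈ S, (Polynomial.C (s a) + if a ∈ S then Polynomial.X else 0))
      = ∏ a ∈ S, (Polynomial.X + Polynomial.C (s a)) :=
    Finset.prod_congr rfl fun a ha => by rw [if_pos ha, add_comm]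
  have hmon : ∀ a ∈ S, (Polynomial.X + Polynomial.C (s a)).Monic := fun a _ => Polynomial.monic_X_add_C _
  have hdeg : (∏ a ∈ S, (Polynomial.X + Polynomial.C (s a))).natDegree = S.card := by
    rw [Polynomial.natDegree_prod_of_monic _ _ hmon]
    simp
  rw [heq, ← hdeg]
  exact (Polynomial.monic_prod_of_monic _ _ hmon).coeff_natDegree

/-! ## 2. The add-row lemma -/

/-- **THE ADD-ROW LEMMA.** In a configuration with `r₀ + 1` rows/columns, let row `i₀` be contained in no other row and let column `k₀`
admit cut constants `c` with `φ_c = 1` at its hidden set and `φ_c = 0` at the hidden sets of the other columns of its piece. If the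
configuration without row `i₀` and column `k₀` is generically good, so is the whole configuration. -/
theorem symGood_addRow {r₀ : ℕ} (u : Fin (r₀ + 1) → Finset (Fin h)) (e : Fin (r₀ + 1) → Fin m × Finset (Fin K))
    (i₀ k₀ : Fin (r₀ + 1)) (c : Option (Fin K) → ℂ)
    (hnew : phi c (e k₀).2 = 1)
    (hold : ∀ j : Fin r₀, (e (k₀.succAbove j)).1 = (e k₀).1 → phi c (e (k₀.succAbove j)).2 = 0)
    (hmax : ∀ j : Fin r₀, ¬ u i₀ ⊆ u (i₀.succAbove j))
    (h0 : symDet (fun j : Fin r₀ => u (i₀.succAbove j)) (fun j => e (k₀.succAbove j)) ≠ 0) :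
    symDet u e ≠ 0 := by
  classical
  intro hD
  set S : Finset (Fin h) := u i₀ with hS
  set Ψ := rowShift (m := m) (K := K) (e k₀).1 c S with hΨ
  set N : Matrix (Fin (r₀ + 1)) (Fin (r₀ + 1)) (Polynomial (MvPolynomial (Var m K h) ℂ)) :=
    Ψ.toRingHom.mapMatrix (symMat u e) with hN
  have hdetN : N.det = 0 := by
    rw [hN, ← RingHom.map_det, show (symMat u e).det = symDet u e from rfl, hD, map_zero]
  -- the entries of the shifted matrix
  have hNapply : ∀ i k, N i k = Ψ (∏ a ∈ u i, symPoint e k a) := by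
    intro i k
    rw [hN, RingHom.mapMatrix_apply, Matrix.map_apply]
    rfl
  have hcolOld : ∀ i (j : Fin r₀), N i (k₀.succAbove j) = Polynomial.C (symMat u e i (k₀.succAbove j)) := by
    intro i j
    rw [hNapply, hΨ, rowShift_entry_const _ _ _ e _ (hold j)]
    rfl
  have hcolNew : ∀ i, N i k₀ = ∏ a ∈ u i, (Polynomial.C (symPoint e k₀ a) + if a ∈ S then Polynomial.X else 0) := by
    intro i
    rw [hNapply, hΨ, rowShift_entry_new _ _ _ e k₀ rfl hnew]
  -- the minors along column `k₀` are constant matrices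
  have hminor : ∀ i : Fin (r₀ + 1), (N.submatrix i.succAbove k₀.succAbove).det
      = Polynomial.C ((symMat u e).submatrix i.succAbove k₀.succAbove).det := by
    intro i
    have : N.submatrix i.succAbove k₀.succAbove
        = (Polynomial.C : MvPolynomial (Var m K h) ℂ →+* _).mapMatrix ((symMat u e).submatrix i.succAbove k₀.succAbove) := by
      ext a b
      rw [Matrix.submatrix_apply, hcolOld, RingHom.mapMatrix_apply, Matrix.map_apply, Matrix.submatrix_apply]
    rw [this, ← RingHom.map_det]
  have hminor0 : ((symMat u e).submatrix i₀.succAbove k₀.succAbove).det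
      = symDet (fun j : Fin r₀ => u (i₀.succAbove j)) (fun j => e (k₀.succAbove j)) := by
    rw [symDet]
    congr 1
  -- Laplace expansion along `k₀` and the coefficient of `T ^ |S|`
  have hlap := Matrix.det_succ_column N k₀
  have hsign : ∀ n : ℕ, ((-1 : Polynomial (MvPolynomial (Var m K h) ℂ)) ^ n)
      = Polynomial.C ((-1 : MvPolynomial (Var m K h) ℂ) ^ n) := by
    intro n; rw [map_pow, map_neg, map_one]
  have hcoef : ∀ i : Fin (r₀ + 1), ((-1) ^ (i + k₀ : ℕ) * N i k₀ * (N.submatrix i.succAbove k₀.succAbove).det).coeff S.card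
      = (-1) ^ (i + k₀ : ℕ) * (N i k₀).coeff S.card * ((symMat u e).submatrix i.succAbove k₀.succAbove).det := by
    intro i
    rw [hminor, Polynomial.coeff_mul_C, hsign, Polynomial.coeff_C_mul]
  have hcoef0 : (N i₀ k₀).coeff S.card = 1 := by
    rw [hcolNew]
    exact coeff_entry_new_self S (fun a => symPoint e k₀ a)
  have hcoefj : ∀ j : Fin r₀, (N (i₀.succAbove j) k₀).coeff S.card = 0 := by
    intro j
    rw [hcolNew]
    apply Polynomial.coeff_eq_zero_of_natDegree_lt
    refine lt_of_le_of_lt (natDegree_entry_new_le S (u (i₀.succAbove j)) fun a => symPoint e k₀ a) ?_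
    apply Finset.card_lt_card
    refine (Finset.ssubset_iff_subset_ne).mpr ⟨Finset.inter_subset_right, fun heq => hmax j ?_⟩
    rw [← heq]
    exact Finset.inter_subset_left
  have key : (N.det).coeff S.card
      = (-1) ^ (i₀ + k₀ : ℕ) * symDet (fun j : Fin r₀ => u (i₀.succAbove j)) (fun j => e (k₀.succAbove j)) := by
    rw [hlap, Polynomial.finsetSum_coeff, Fin.sum_univ_succAbove _ i₀, hcoef, hcoef0, mul_one, hminor0,
      Finset.sum_eq_zero (fun j _ => by rw [hcoef, hcoefj, mul_zero, zero_mul]), add_zero]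
  rw [hdetN, Polynomial.coeff_zero] at key
  have hunit : ((-1 : MvPolynomial (Var m K h) ℂ) ^ (i₀ + k₀ : ℕ)) ≠ 0 := pow_ne_zero _ (neg_ne_zero.mpr one_ne_zero)
  exact (mul_ne_zero hunit h0) key.symm

/-! ## 3. The private-state form -/

/-- **Add-row lemma, private-state form.** If the hidden set of column `k₀` contains a state `q` that no other column of the same
piece contains (the usual way free points are realised: a star piece `{∅} ∪ {{q}}`, or any fresh state), row `i₀` is contained in no
other row, and the configuration without `i₀, k₀` is generically good, then so is the whole configuration. -/
theorem symGood_addRow_private {r₀ : ℕ} (u : Fin (r₀ + 1) → Finset (Fin h)) (e : Fin (r₀ + 1) → Fin m × Finset (Fin K))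
    (i₀ k₀ : Fin (r₀ + 1)) (q : Fin K) (hq : q ∈ (e k₀).2)
    (hpriv : ∀ j : Fin r₀, (e (k₀.succAbove j)).1 = (e k₀).1 → q ∉ (e (k₀.succAbove j)).2)
    (hmax : ∀ j : Fin r₀, ¬ u i₀ ⊆ u (i₀.succAbove j))
    (h0 : symDet (fun j : Fin r₀ => u (i₀.succAbove j)) (fun j => e (k₀.succAbove j)) ≠ 0) :
    symDet u e ≠ 0 := by
  classical
  refine symGood_addRow u e i₀ k₀ (fun o => Option.elim o 0 fun q' => if q' = q then 1 else 0) ?_ ?_ hmax h0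
  · simp [phi, Finset.sum_ite_eq', hq]
  · intro j hj
    simp [phi, Finset.sum_ite_eq', hpriv j hj]

end SymbJoin

end

end Summit.ValiantsHypothesis.ValiantsHypothesis.Theorems.BarrierLever.HiddenStates
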